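import Literature.MathematicalPhysics.QuantumFieldTheory.Balaban1983to89.T4AxialGaugeSmallField
import Literature.MathematicalPhysics.QuantumFieldTheory.Balaban1983to89.UnitaryModel
import HarnessLib

/-!
# Route «BalabanUVNodes» (cluster K4 «SpineRates»), Track-A DAG node N15 = NE2, BACKGROUND LAYER — THE SMALL-FIELD AXIAL GAUGE AT THE GAUGE GROUP OF RECORD `U(N)`, READ IN THE
# CURRENCY OF THE CURVED SPECIES' GROUP-LEVEL LETTERS: plaquette-small `U(N)` configuration on a non-wrapping box ⟹ in the corner-rooted axial gauge every bond variable satisfies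
# `‖U^u(b) − 1‖_F ≤ √|n|·(d − 1)·N·δ` (FROBENIUS norm — the letter `…CurvedPerturbationLettersUN` consumes), via `‖A‖_F ≤ √|n|·‖A‖_{op}`

Cell `pub-ymgap`, seat `pub-ymgap-dag-n15-w2` (WIDTH SEAT 2∕3 on node N15, director-ym №197 ∕ HUMAN RULING D-0149), g5, third piece = this seat's g4 offer (o2) «axial-gauge BRIDGE pub-balaban
`T4AxialGaugeSmallField` → (3.35) transporter letters» at group level (bus CLAIM-3).  `bears_on: R4∕N15 · K3⁸ SpineGivenEndpointR13SepCoPHV (stmt-QuantumFields-27366)`.  Filed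
`--kind proof --supports stmt-QuantumFields-27366 --as helper` — COUNT-NEUTRAL.  Theorems only; 0 `def`, 0 `sorry`.  Imports BY NAME pub-balaban's `T4AxialGaugeSmallField`
(`axialGauge`, `boxBonds`, `boxPlaqs`, `castSite`, `dist1_gaugeAct_axialGauge_le_of_mem_boxBonds` — the torus non-abelian Poincaré lemma, ANY gauge group) and `UnitaryModel`
(`instGaugeGroupUnitaryGroup`: `dist1 U = ‖U − 1‖` in the L²-OPERATOR norm, `UnitaryModel.opDist1`), Mathlib's two matrix norm scopes (`Matrix.Norms.L2Operator`, `Matrix.Norms.Frobenius`);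
nothing in the tree is modified, no landed name re-declared (the tree's N12 junction `…N12SmallFieldAxialGaugeOfBackground` is the `SU(2)`-chart analogue for node N12; not imported).

WHY.  (3.35) p. 396 of [Balaban1985BackgroundPropagators]: «for a configuration U there exists a gauge transformation u on □ such that U^u = e^{iηA} and … |A| < O(1)Mα₀(L^jη)^{−1},
|∇^η_U A| < O(1)Mα₀(L^jη)^{−2} on □».  The group-level content of the FIRST inequality is «plaquette-small on a cube ⟹ in a tree (axial) gauge every bond variable is close to 1»
([Balaban1985Averaging] Lemma 1-type, typed on the torus carrier by pub-balaban's `T4AxialGaugeSmallField` for any `GaugeGroup`, with `dist1`).  This seat's `…CurvedPerturbationLettersUN`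
(g5 FILE 2) reads the curved species' transporter letter off `‖U_μ(x) − 1‖_F` in the FROBENIUS norm of `M_N(ℂ)` (the norm under which `Ad` and the trace-form coordinates were
estimated, g2∕g4).  THIS FILE closes the currency gap and states the junction at `G = U(N)`:
* §1 (Mathlib only) `sqrt_sum_sq_col_le_l2_opNorm` (a column's Euclidean norm ≤ the L²-operator norm), `sum_sq_entries_le_card_mul_l2_opNorm_sq`, ★ `frobenius_norm_le_sqrt_card_mul_l2_opNorm`
  (`‖A‖_F ≤ √|n|·‖A‖_{op}` for `A ∈ M_n(ℂ)`);
* §2 ★ `uN_frobenius_norm_sub_one_le_of_dist1` (`‖U − 1‖_F ≤ √|n|·dist1 U` for `U ∈ U(n)` with the tree's `GaugeGroup` structure), `uN_coe_conjTranspose_mul_self` (`UᴴU = 1`, the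
  unitarity hypothesis shape of FILE 2);
* §3 ★★★ `uN_frobenius_gaugeAct_axialGauge_le_of_mem_boxBonds` — plaquettes `< δ` on the plaquettes of a non-wrapping box of `N + 1` sites per direction (`S₀ ⊇ boxPlaqs lo hi`,
  `hi ≤ lo + N`, `N < sitesPerDir j`, `0 ≤ δ`) ⟹ every bond variable of the box in the axial gauge has `‖U^u(b) − 1‖_F ≤ √|n|·((d − 1)·N·δ)`; ★★ `uN_exists_gauge_frobenius_le_of_plaqSmallOn`
  (∃-form: a gauge transformation with that bound on all box bonds) — the `a`-letter `‖U − 1‖_F ≤ ηa` of FILE 2's `uN_transporterLetter_group` ∕ `uN_hasMaj_unstackM_tCoef_gaugePair_group_rate`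
  with `ηa := √|n|(d − 1)Nδ`.

HONEST FRAMING ∕ LIMITS.  (a) Only the FIRST inequality of (3.35) (the sup letter) is produced; the SECOND (`|∇^η_U A|`, equivalently FILE 2's covariant-backward-difference letter `b`) needs the
smooth Sect.-F gauge of [Balaban1985PropagatorsII] and is NOT produced here — consumers keep it displayed.  (b) Box only, non-wrapping; nothing on the whole torus.  (c) Constant
`(d − 1)·N` = the corner-rooted tree of `T4AxialGaugeSmallField` (print: `O(1)M`); `√|n|` = the crude operator-to-Frobenius conversion; no constant optimised.  (d) `PlaqSmallOn` is strict,
conclusions are `≤`.  (e) Group level only (no logarithm∕chart: the `U(N)` edition deliberately avoids `A = (1∕iη) log U^u`).  Count-neutral junction; nothing of [B5]∕[B6]∕[B9] asserted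
beyond the cited shapes; NE2⁺ NOT PRINTED ∕ NOT proved; N15 NOT discharged; K3⁸ OPEN, skeleton v6 untouched; counts of record UNMOVED (typed 28∕28 · discharged 5∕27 · A 5∕28); one
finite 𝕋⁴ at fixed ε — NOT ℝ⁴ ∕ OS ∕ mass gap ∕ Clay; R4 closes the conditional finite-𝕋⁴ rung `BalabanLadder.UV` only.  Restate-immune (no Theses import).
-/

set_option autoImplicit false

noncomputable section
open scoped BigOperators Matrix

namespace Summit.QuantumFields.YangMills.BalabanUVNodes.N15.CurvedSpecies

/-! ## §1 `‖A‖_F ≤ √|n|·‖A‖_{op}` on `M_n(ℂ)` -/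

section OpFrobenius

open scoped Matrix.Norms.L2Operator

variable {n : Type} [Fintype n] [DecidableEq n]

/-- A COLUMN's Euclidean norm is at most the L²-operator norm: `√(Σ_i |A_{ij}|²) = ‖A e_j‖₂ ≤ ‖A‖_{op}` (`‖e_j‖₂ = 1`). [folklore] -/
theorem sqrt_sum_sq_col_le_l2_opNorm (A : Matrix n n ℂ) (j : n) : Real.sqrt (∑ i, ‖A i j‖ ^ 2) ≤ ‖A‖ := by
  have hx : ‖(EuclideanSpace.single j (1 : ℂ))‖ = 1 := by rw [PiLp.norm_single, norm_one]
  have h := Matrix.l2_opNorm_mulVec A (EuclideanSpace.single j (1 : ℂ))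
  rw [hx, mul_one, EuclideanSpace.norm_eq] at h
  convert h using 4 with i
  simp

/-- Summing the columns: `Σ_{i,j} |A_{ij}|² ≤ |n|·‖A‖²_{op}`. [folklore] -/
theorem sum_sq_entries_le_card_mul_l2_opNorm_sq (A : Matrix n n ℂ) : ∑ i, ∑ j, ‖A i j‖ ^ 2 ≤ Fintype.card n * ‖A‖ ^ 2 := by
  rw [Finset.sum_comm]
  calc ∑ j, ∑ i, ‖A i j‖ ^ 2 ≤ ∑ _j : n, ‖A‖ ^ 2 := Finset.sum_le_sum fun j _ => by
          have h0 : 0 ≤ ∑ i, ‖A i j‖ ^ 2 := Finset.sum_nonneg fun i _ => by positivity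
          calc ∑ i, ‖A i j‖ ^ 2 = (Real.sqrt (∑ i, ‖A i j‖ ^ 2)) ^ 2 := (Real.sq_sqrt h0).symm
            _ ≤ ‖A‖ ^ 2 := by gcongr; exact sqrt_sum_sq_col_le_l2_opNorm A j
    _ = Fintype.card n * ‖A‖ ^ 2 := by rw [Finset.sum_const, Finset.card_univ, nsmul_eq_mul]

end OpFrobenius

section Frobenius

open scoped Matrix.Norms.Frobenius

variable {n : Type} [Fintype n] [DecidableEq n]

/-- ★ **`‖A‖_F ≤ √|n|·‖A‖_{op}`**: the Frobenius (Hilbert–Schmidt) norm of a complex `n × n` matrix is at most `√|n|` times its L²-operator norm (the right-hand norm is Mathlib's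
`Matrix.instL2OpNormedAddCommGroup`, written explicitly since this section's instances are the Frobenius ones). [folklore] -/
theorem frobenius_norm_le_sqrt_card_mul_l2_opNorm (A : Matrix n n ℂ) :
    ‖A‖ ≤ Real.sqrt (Fintype.card n) * @Norm.norm _ Matrix.instL2OpNormedAddCommGroup.toNorm A := by
  have h := sum_sq_entries_le_card_mul_l2_opNorm_sq A
  have hA : 0 ≤ @Norm.norm _ Matrix.instL2OpNormedAddCommGroup.toNorm A :=
    @norm_nonneg _ Matrix.instL2OpNormedAddCommGroup.toSeminormedAddCommGroup.toSeminormedAddGroup A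
  rw [Matrix.frobenius_norm_def, ← Real.sqrt_eq_rpow]
  calc Real.sqrt (∑ i, ∑ j, ‖A i j‖ ^ (2 : ℝ)) = Real.sqrt (∑ i, ∑ j, ‖A i j‖ ^ 2) := by simp_rw [Real.rpow_two]
    _ ≤ Real.sqrt (Fintype.card n * (@Norm.norm _ Matrix.instL2OpNormedAddCommGroup.toNorm A) ^ 2) := Real.sqrt_le_sqrt h
    _ = Real.sqrt (Fintype.card n) * @Norm.norm _ Matrix.instL2OpNormedAddCommGroup.toNorm A := by rw [Real.sqrt_mul (Nat.cast_nonneg _), Real.sqrt_sq hA]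

/-! ## §2 `U(n)` with the tree's `GaugeGroup` structure: `‖U − 1‖_F ≤ √|n|·dist1 U`; unitarity in FILE 2's shape -/

open Literature.MathematicalPhysics.QuantumFieldTheory.Balaban1983to89

variable [Nonempty n]

/-- ★ **THE INTERFACE DISTANCE CONTROLS THE FROBENIUS LETTER**: for `U ∈ U(n)` (the tree's `instGaugeGroupUnitaryGroup`: `dist1 U = ‖U − 1‖_{op}`, [Balaban1985Averaging] (19)),
`‖U − 1‖_F ≤ √|n|·dist1 U`. [cite: Balaban1985Averaging, (19) p.21] -/
theorem uN_frobenius_norm_sub_one_le_of_dist1 (U : Matrix.unitaryGroup n ℂ) : ‖(U : Matrix n n ℂ) - 1‖ ≤ Real.sqrt (Fintype.card n) * dist1 U := by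
  have h := frobenius_norm_le_sqrt_card_mul_l2_opNorm ((U : Matrix n n ℂ) - 1)
  exact h

omit [Nonempty n] in
/-- `UᴴU = 1` for `U ∈ U(n)` — the unitarity hypothesis shape of `…CurvedPerturbationLettersUN`. [folklore] -/
theorem uN_coe_conjTranspose_mul_self (U : Matrix.unitaryGroup n ℂ) : (U : Matrix n n ℂ)ᴴ * (U : Matrix n n ℂ) = 1 :=
  Matrix.mem_unitaryGroup_iff'.mp U.2

/-! ## §3 The junction: plaquette-small `U(N)` configuration on a non-wrapping box ⟹ the axial-gauge bond variables are Frobenius-close to `1` -/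

open Literature.MathematicalPhysics.QuantumFieldTheory.Balaban1983to89.T4AxialGaugeSmallField

variable {P : Params} {j : ℕ}

/-- ★★★ **PLAQUETTE-SMALL ON A BOX ⟹ EVERY AXIAL-GAUGE BOND VARIABLE IS FROBENIUS-CLOSE TO `1`** at `G = U(N)`: if `|U(∂p) − 1| < δ` (operator norm) on the plaquettes of a non-wrapping box
`[lo, hi]` of `N + 1` sites per direction (`S₀ ⊇ boxPlaqs lo hi`, `hi ≤ lo + N`, `N < sitesPerDir j`, `0 ≤ δ`), then for every bond `b` of the box the axial-gauge copy satisfies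
`‖U^u(b) − 1‖_F ≤ √|n|·((d − 1)·N·δ)`, `u = axialGauge U lo hi` — pub-balaban's `dist1_gaugeAct_axialGauge_le_of_mem_boxBonds` (any gauge group) read through §2.  The FIRST inequality of
(3.35) at group level in the Frobenius currency; the second is NOT produced. [cite: Balaban1985BackgroundPropagators, (3.35) p.396 (first inequality: shape); Balaban1985Averaging, (19) p.21] -/
theorem uN_frobenius_gaugeAct_axialGauge_le_of_mem_boxBonds (U : GaugeField P j (Matrix.unitaryGroup n ℂ)) {lo hi : Fin P.d → ℤ} {δ : ℝ} {S₀ : Set (Plaq P j)} {N : ℕ}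
    (hS₀ : boxPlaqs lo hi ⊆ S₀) (hU : PlaqSmallOn S₀ δ U) (hδ : 0 ≤ δ) (hn : ∀ κ, hi κ ≤ lo κ + N) (hnN : N < P.sitesPerDir j) {b : PBond P j} (hb : b ∈ boxBonds lo hi) :
    ‖((GaugeField.gaugeAct (axialGauge U lo hi) U b : Matrix.unitaryGroup n ℂ) : Matrix n n ℂ) - 1‖ ≤ Real.sqrt (Fintype.card n) * (((P.d - 1 : ℕ) : ℝ) * N * δ) :=
  (uN_frobenius_norm_sub_one_le_of_dist1 _).trans
    (mul_le_mul_of_nonneg_left (dist1_gaugeAct_axialGauge_le_of_mem_boxBonds U hS₀ hU hδ hn hnN hb) (Real.sqrt_nonneg _))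

/-- ★★ **∃-FORM**: under the same hypotheses there is a gauge transformation (`u :=` the axial gauge, `= 1` off the box by its definition) in which every bond variable of the box has
`UᴴU = 1` and `‖U^u(b) − 1‖_F ≤ √|n|·((d − 1)·N·δ)` — the `a`-letter `‖U − 1‖_F ≤ ηa` of `…CurvedPerturbationLettersUN` (`uN_transporterLetter_group`, `uN_hasMaj_unstackM_tCoef_gaugePair_group_rate`)
with `ηa := √|n|(d − 1)Nδ`, for the bond variables of a genuine small-field configuration. [cite: Balaban1985BackgroundPropagators, (3.35) p.396 (shape); Balaban1985Averaging, (19) p.21] -/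
theorem uN_exists_gauge_frobenius_le_of_plaqSmallOn (U : GaugeField P j (Matrix.unitaryGroup n ℂ)) {lo hi : Fin P.d → ℤ} {δ : ℝ} {S₀ : Set (Plaq P j)} {N : ℕ}
    (hS₀ : boxPlaqs lo hi ⊆ S₀) (hU : PlaqSmallOn S₀ δ U) (hδ : 0 ≤ δ) (hn : ∀ κ, hi κ ≤ lo κ + N) (hnN : N < P.sitesPerDir j) :
    ∃ u : GaugeTransf P j (Matrix.unitaryGroup n ℂ), ∀ b ∈ boxBonds lo hi,
      ((GaugeField.gaugeAct u U b : Matrix.unitaryGroup n ℂ) : Matrix n n ℂ)ᴴ * ((GaugeField.gaugeAct u U b : Matrix.unitaryGroup n ℂ) : Matrix n n ℂ) = 1 ∧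
        ‖((GaugeField.gaugeAct u U b : Matrix.unitaryGroup n ℂ) : Matrix n n ℂ) - 1‖ ≤ Real.sqrt (Fintype.card n) * (((P.d - 1 : ℕ) : ℝ) * N * δ) :=
  ⟨axialGauge U lo hi, fun _ hb => ⟨uN_coe_conjTranspose_mul_self _, uN_frobenius_gaugeAct_axialGauge_le_of_mem_boxBonds U hS₀ hU hδ hn hnN hb⟩⟩

end Frobenius

end Summit.QuantumFields.YangMills.BalabanUVNodes.N15.CurvedSpecies

end
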